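import Summits.CriticalPhenomena.PercolationContinuityZ3.Theorems.PercNearOneGluingNoHeavyQuantFarSeparation
import Summits.CriticalPhenomena.PercolationContinuityZ3.Theorems.PercNearOneGluingNoHeavyQuantSecondWeightLevels
import HarnessLib

/-!
# QUANT lane R8: FAR AT LAYER ONE ON EVERY FINITE WEIGHTED GRAPH WHOSE OBSERVER SEPARATES ONE RELAY FROM THE OTHERS
# (the "root-hair" multi-companion inequality with the independence plumbing)

builds on p205010 (kernel theorem, internal audit signed; external expert review pending)

Support file (`--supports stmt-CriticalPhenomena-4575`), seat `prim-cert-1` (gen 20); QUANT lane rung R8, front "FAR beyond trees" (lead g22).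
prim-quant-p1 g16 (`FOR-LEAD-TWOCHAIN-A.md` §2) observed that the multi-companion inequality is UNIVERSAL for a relay independent of its
companions: if `𝟙[o ↔ a]` is independent of the other relays' connection events, `P(o ↔ a) ≥ x`, `P(o ↔ b) ≥ x` and `Σ_{b ≠ a} P(o ↔ b) ≥ 1`,
then `P(N ≥ 2) = P(o ↔ a)·P(C ≥ 1) + P(o ↮ a)·P(C ≥ 2) ≥ x` (`C` = number of other relays joined to `o`) — the real-algebra core is
`Quant.SecondWeight.level_reduce` with one level — and asked "whoever has the independence plumbing" for the graph corollary.  Here it is: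

* SEPARATION (`…QuantFarSeparation`: `Quant.openConn_iff_openConnIn_of_sep` / `_compl_of_sep`): if the weight function vanishes on every pair
  `{u, v}` with `u ∈ S`, `v ∉ S`, `v ≠ o` (`o ∉ S`: the observer is a cut vertex between `S` and the rest), then almost surely
  `o ↔ a ⟺ o ↔ a inside S ∪ {o}` for `a ∈ S` and `o ↔ b ⟺ o ↔ b inside Sᶜ` for `b ∉ S`; the two sides are determined by DISJOINT sets of
  pairs, hence independent under `prodBernoulli w` (`prodBernoulli_real_inter_of_determinedBy_disjoint`).
* `Quant.farRelayRow_layerOne_of_separated` — **the `j = 1` instance of `Quant.FarRelayRow` on EVERY finite weighted graph in which some relay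
  `a ∈ A` is separated from `A ∖ {a}` by the observer** (`a ∈ S`, `A ∖ {a} ⊆ Sᶜ`, `o ∉ S`, no weight between `S` and `Sᶜ ∖ {o}`):
  `2 < Σ_{b∈A} P(o ↔ b)` and `P(o ↮ b) ≤ t` on `A` imply `P(#{b ∈ A | o ↔ b} ≤ 1) ≤ t`.  (`a` need NOT be the least likely relay; `o ∈ A` allowed.)
* `Quant.farRelayRow_layerOne_of_pendant` — in particular when some relay `a ≠ o` is a PENDANT NEIGHBOUR OF THE OBSERVER (`w(a, v) = 0` for `v ≠ o, a`).
Counting: `P(C = 1) ≤ Σ_b P(o ↔ b) ≤ P(C = 1) + |A ∖ a|·P(C ≥ 2)` (union bound / disjointness on `{C = 1}`), then `level_reduce`.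
No sorries; standard axioms.  [cite: KozmaNitzan2024, Lemma 2 (p. 6), Conjecture 3 (p. 15)] (the row); [cite: Grimmett1999, §1.3 p. 10; §2.2]
(product measure; events determined by disjoint sets of edges are independent); the theorems [this work] (observation: prim-quant-p1 g16 §2).
-/

noncomputable section

namespace Summit.CriticalPhenomena.PercolationContinuityZ3.Theorems

namespace Quant

open MeasureTheory Finset
open Literature.Probability.LatticeModels
open Literature.Probability.Percolation
open scoped Classical

variable {n : ℕ}

/-! ## The row -/

/-- **FAR AT LAYER ONE WHEN THE OBSERVER SEPARATES ONE RELAY FROM THE OTHERS** (the `j = 1` body of `Quant.FarRelayRow` for these weight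
functions): `o ∉ S`, a relay `a ∈ A ∩ S`, all other relays off `S`, and `w` vanishes on every pair between `S` and `Sᶜ ∖ {o}`.
Then `2 < Σ_{b∈A} P(o ↔ b)` and `P(o ↮ b) ≤ t` for all `b ∈ A` imply `P(#{b ∈ A | o ↔ b} ≤ 1) ≤ t`. [this work] -/
theorem farRelayRow_layerOne_of_separated (n : ℕ) (w : Sym2 (Fin n) → unitInterval) (A : Finset (Fin n)) (o a : Fin n)
    (S : Set (Fin n)) (hoS : o ∉ S) (haS : a ∈ S) (haA : a ∈ A)
    (hAS : ∀ b ∈ A, b ≠ a → b ∉ S)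
    (hsep : ∀ u v : Fin n, u ∈ S → v ∉ S → v ≠ o → w s(u, v) = 0)
    (t : ℝ) (hEN : (2 : ℝ) < ∑ b ∈ A, (prodBernoulli w).real (openConn o b))
    (hcut : ∀ b ∈ A, (prodBernoulli w).real (openConn o b : Set (BondConfig (Fin n)))ᶜ ≤ t) :
    (prodBernoulli w).real {ω : BondConfig (Fin n) | (A.filter fun b => ω ∈ openConn o b).card ≤ 1} ≤ t := by
  set μ := prodBernoulli w with hμ
  have hmeas : ∀ X : Set (BondConfig (Fin n)), MeasurableSet X := fun X => (Set.toFinite X).measurableSet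
  set B : Finset (Fin n) := A.erase a with hB
  -- the inside events
  set Ea : Set (BondConfig (Fin n)) := openConnIn (insert o S) o a with hEa
  set Eb : Fin n → Set (BondConfig (Fin n)) := fun b => openConnIn Sᶜ o b with hEb
  set cnt : BondConfig (Fin n) → ℕ := fun ω => (B.filter fun b => ω ∈ Eb b).card with hcnt
  -- marginals
  set T : Fin n → ℝ := fun b => μ.real (openConn o b) with hT
  have hBsub : ∀ b ∈ B, b ∈ A ∧ b ≠ a := fun b hb => ⟨Finset.mem_of_mem_erase hb, Finset.ne_of_mem_erase hb⟩
  have hBS : ∀ b ∈ B, b ∉ S := fun b hb => hAS b (hBsub b hb).1 (hBsub b hb).2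
  -- a.s. identifications
  have hEa_eq : μ.real Ea = T a :=
    (WitnessSeparated.measureReal_congr_support w fun ω hω => (openConn_iff_openConnIn_of_sep w S o hoS hsep hω haS)).symm
  have hEb_eq : ∀ b ∈ B, μ.real (Eb b) = T b := fun b hb =>
    (WitnessSeparated.measureReal_congr_support w fun ω hω => (openConn_iff_openConnIn_compl_of_sep w S o hoS hsep hω (hBS b hb))).symm
  -- the three count events
  set D0 : Set (BondConfig (Fin n)) := {ω | cnt ω = 0} with hD0
  set D1 : Set (BondConfig (Fin n)) := {ω | cnt ω = 1} with hD1
  set D2 : Set (BondConfig (Fin n)) := {ω | 2 ≤ cnt ω} with hD2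
  set Dle : Set (BondConfig (Fin n)) := {ω | cnt ω ≤ 1} with hDle
  have hzst : μ.real D0 + μ.real D1 + μ.real D2 = 1 := by
    have hd01 : Disjoint D0 D1 := by
      rw [Set.disjoint_left]; intro ω h0 h1'
      simp only [hD0, hD1, Set.mem_setOf_eq] at h0 h1'; omega
    have hd2 : Disjoint (D0 ∪ D1) D2 := by
      rw [Set.disjoint_left]; intro ω h01 h2'
      simp only [hD0, hD1, hD2, Set.mem_setOf_eq, Set.mem_union] at h01 h2'; omega
    have huniv : D0 ∪ D1 ∪ D2 = Set.univ := by
      ext ω; simp only [hD0, hD1, hD2, Set.mem_union, Set.mem_setOf_eq, Set.mem_univ, iff_true]; omega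
    rw [← measureReal_union hd01 (hmeas _), ← measureReal_union hd2 (hmeas _), huniv, probReal_univ]
  have hDle_eq : μ.real Dle = μ.real D0 + μ.real D1 := by
    have hd01 : Disjoint D0 D1 := by
      rw [Set.disjoint_left]; intro ω h0 h1'
      simp only [hD0, hD1, Set.mem_setOf_eq] at h0 h1'; omega
    have : Dle = D0 ∪ D1 := by
      ext ω; simp only [hDle, hD0, hD1, Set.mem_union, Set.mem_setOf_eq]; omega
    rw [this, measureReal_union hd01 (hmeas _)]
  -- determination by disjoint sets of pairs, independence
  set F : Finset (Sym2 (Fin n)) := univ.filter fun e => (∀ z ∈ e, z ∈ insert o S) ∧ ¬ e.IsDiag with hF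
  set F' : Finset (Sym2 (Fin n)) := univ.filter fun e => (∀ z ∈ e, z ∉ S) ∧ ¬ e.IsDiag with hF'
  have hFF' : Disjoint F F' := by
    rw [Finset.disjoint_left]
    intro e he he'
    rw [hF, Finset.mem_filter] at he
    rw [hF', Finset.mem_filter] at he'
    induction e using Sym2.ind with
    | _ x y =>
      have hx : x ∈ insert o S := he.2.1 x (Sym2.mem_mk_left x y)
      have hy : y ∈ insert o S := he.2.1 y (Sym2.mem_mk_right x y)
      have hx' : x ∉ S := he'.2.1 x (Sym2.mem_mk_left x y)
      have hy' : y ∉ S := he'.2.1 y (Sym2.mem_mk_right x y)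
      rw [Set.mem_insert_iff] at hx hy
      have hxo : x = o := hx.resolve_right hx'
      have hyo : y = o := hy.resolve_right hy'
      exact he.2.2 (Sym2.mk_isDiag_iff.2 (hxo.trans hyo.symm))
  have hdetA : DeterminedBy Ea (↑F : Set (Sym2 (Fin n))) := by
    refine determinedBy_openConnIn_of_pairs (insert o S) o a fun u v hu hv huv => ?_
    rw [Finset.mem_coe, hF, Finset.mem_filter]
    refine ⟨Finset.mem_univ _, fun z hz => ?_, fun hd => huv (Sym2.mk_isDiag_iff.1 hd)⟩
    rcases Sym2.mem_iff.1 hz with rfl | rfl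
    · exact hu
    · exact hv
  have hdetB : ∀ b, DeterminedBy (Eb b) (↑F' : Set (Sym2 (Fin n))) := by
    intro b
    refine determinedBy_openConnIn_of_pairs Sᶜ o b fun u v hu hv huv => ?_
    rw [Finset.mem_coe, hF', Finset.mem_filter]
    refine ⟨Finset.mem_univ _, fun z hz => ?_, fun hd => huv (Sym2.mk_isDiag_iff.1 hd)⟩
    rcases Sym2.mem_iff.1 hz with rfl | rfl
    · exact hu
    · exact hv
  have hdetCnt : ∀ P : ℕ → Prop, DeterminedBy {ω | P (cnt ω)} (↑F' : Set (Sym2 (Fin n))) := by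
    intro P
    rw [determinedBy_iff]
    intro ω ω' hωω'
    have hc : cnt ω = cnt ω' := by
      simp only [hcnt]
      congr 1
      refine Finset.filter_congr fun b _ => ?_
      exact (determinedBy_iff _ _).1 (hdetB b) ω ω' hωω'
    simp only [Set.mem_setOf_eq, hc]
  have hindep : ∀ P : ℕ → Prop, μ.real (Ea ∩ {ω | P (cnt ω)}) = μ.real Ea * μ.real {ω | P (cnt ω)} := fun P =>
    prodBernoulli_real_inter_of_determinedBy_disjoint w hFF' hdetA (hdetCnt P) (hmeas _) (hmeas _)
  -- the relay count splits as `𝟙[Ea] + cnt` almost surely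
  have hN : μ.real {ω : BondConfig (Fin n) | (A.filter fun b => ω ∈ openConn o b).card ≤ 1} =
      μ.real ((Ea ∩ D0) ∪ (Eaᶜ ∩ Dle)) := by
    refine WitnessSeparated.measureReal_congr_support w fun ω hω => ?_
    have hfilt : (A.filter fun b => ω ∈ openConn o b).card = (if ω ∈ Ea then 1 else 0) + cnt ω := by
      have hAins : A = insert a B := by rw [hB, Finset.insert_erase haA]
      have hBfilt : (B.filter fun b => ω ∈ openConn o b) = B.filter fun b => ω ∈ Eb b :=
        Finset.filter_congr fun b hb => openConn_iff_openConnIn_compl_of_sep w S o hoS hsep hω (hBS b hb)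
      have haB : a ∉ B.filter fun b => ω ∈ openConn o b := fun h => Finset.notMem_erase a A (Finset.mem_filter.1 h).1
      rw [hAins, Finset.filter_insert]
      by_cases ha : ω ∈ openConn o a
      · have ha' : ω ∈ Ea := (openConn_iff_openConnIn_of_sep w S o hoS hsep hω haS).1 ha
        rw [if_pos ha, Finset.card_insert_of_notMem haB, if_pos ha', hBfilt]
        simp only [hcnt]; omega
      · have ha' : ω ∉ Ea := fun h => ha ((openConn_iff_openConnIn_of_sep w S o hoS hsep hω haS).2 h)
        rw [if_neg ha, if_neg ha', hBfilt]
        simp only [hcnt]; omega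
    simp only [Set.mem_setOf_eq, Set.mem_union, Set.mem_inter_iff, Set.mem_compl_iff, hD0, hDle, hfilt]
    by_cases ha' : ω ∈ Ea
    · simp only [ha', if_true, not_true_eq_false, false_and, or_false, true_and]; omega
    · simp only [ha', if_false, not_false_eq_true, true_and, false_and, false_or]; omega
  have hdisjU : Disjoint (Ea ∩ D0) (Eaᶜ ∩ Dle) := by
    rw [Set.disjoint_left]
    rintro ω ⟨h1', -⟩ ⟨h2', -⟩
    exact h2' h1'
  have hcompl : μ.real (Eaᶜ ∩ Dle) = (1 - μ.real Ea) * μ.real Dle := by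
    have h := measureReal_inter_add_sdiff (μ := μ) (s := Dle) (hmeas Ea)
    -- `Dle ∩ Ea` + `Dle \ Ea`
    have h' : Dle \ Ea = Eaᶜ ∩ Dle := by ext ω; simp [and_comm]
    rw [h', Set.inter_comm, hindep (fun c => c ≤ 1)] at h
    linarith
  rw [hN, measureReal_union hdisjU (hmeas _), hindep (fun c => c = 0), hcompl]
  -- notation for the arithmetic
  set x := μ.real Ea with hx
  set z := μ.real D0 with hz
  set s := μ.real D1 with hs
  set t2 := μ.real D2 with ht2
  set m := ∑ b ∈ B, T b with hm
  have hzle : μ.real Dle = z + s := hDle_eq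
  rw [hzle]
  have hz0 : 0 ≤ z := measureReal_nonneg
  have hs0 : 0 ≤ s := measureReal_nonneg
  have ht20 : 0 ≤ t2 := measureReal_nonneg
  have hx1 : x ≤ 1 := measureReal_le_one
  have hx0 : 0 ≤ x := measureReal_nonneg
  -- `x = T a`, `m = Σ_B T b`, the mean hypothesis
  have hsumA : ∑ b ∈ A, T b = T a + m := by
    rw [hm, hB, ← Finset.add_sum_erase A T haA]
  have hTa1 : T a ≤ 1 := measureReal_le_one
  have hm1 : 1 < m := by
    have : (2 : ℝ) < T a + m := by rw [← hsumA]; exact hEN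
    linarith
  -- the floor `x' = 1 - t`
  have hcut' : ∀ b ∈ A, 1 - t ≤ T b := by
    intro b hb
    have := hcut b hb
    rw [probReal_compl_eq_one_sub (hmeas _)] at this
    simp only [hT]; linarith
  have hxa : 1 - t ≤ x := by rw [hEa_eq]; exact hcut' a haA
  -- counting bounds
  have hcb := count_bounds μ B Eb (fun b _ => hmeas _) (hmeas _) (hmeas _)
  have hsumB : ∑ b ∈ B, μ.real (Eb b) = m := Finset.sum_congr rfl fun b hb => hEb_eq b hb
  rw [hsumB] at hcb
  obtain ⟨hsm, hms⟩ := hcb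
  have hBne : 1 ≤ B.card := by
    by_contra hlt
    push Not at hlt
    have hB0 : B = ∅ := Finset.card_eq_zero.1 (by omega)
    have : m = 0 := by rw [hm, hB0, Finset.sum_empty]
    linarith
  have hnx : (B.card : ℝ) * (1 - t) ≤ 1 * m := by
    rw [one_mul, hm]
    have : ∑ b ∈ B, (1 - t) ≤ ∑ b ∈ B, T b := Finset.sum_le_sum fun b hb => hcut' b (hBsub b hb).1
    rwa [Finset.sum_const, nsmul_eq_mul] at this
  -- the two cases of the floor
  by_cases hxpos : 0 < 1 - t
  · have key := SecondWeight.level_reduce (1 - t) 1 z s t2 m 0 (1 - t) 1 B.card hxpos hBne hz0 hs0 ht20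
      (by linarith [hzst]) hsm (by simpa using hms) hnx le_rfl zero_le_one le_rfl le_rfl (by linarith)
    rcases key with h | ⟨hm1', _⟩
    · -- `1 - t ≤ s (1 - t) + t2`
      nlinarith [mul_le_mul_of_nonneg_right hxa hs0]
    · linarith
  · push Not at hxpos
    nlinarith [mul_le_mul_of_nonneg_right hx1 hz0]

/-- **FAR at layer one when some relay is a PENDANT NEIGHBOUR OF THE OBSERVER** (its only possible neighbour is `o`): on every finite weighted
graph, `a ∈ A`, `a ≠ o`, `w(a, v) = 0` for all `v ∉ {o, a}`, `2 < Σ_{b∈A} P(o ↔ b)` and `P(o ↮ b) ≤ t` on `A` imply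
`P(#{b ∈ A | o ↔ b} ≤ 1) ≤ t`. [this work] -/
theorem farRelayRow_layerOne_of_pendant (n : ℕ) (w : Sym2 (Fin n) → unitInterval) (A : Finset (Fin n)) (o a : Fin n)
    (haA : a ∈ A) (hao : a ≠ o) (hpend : ∀ v : Fin n, v ≠ a → v ≠ o → w s(a, v) = 0)
    (t : ℝ) (hEN : (2 : ℝ) < ∑ b ∈ A, (prodBernoulli w).real (openConn o b))
    (hcut : ∀ b ∈ A, (prodBernoulli w).real (openConn o b : Set (BondConfig (Fin n)))ᶜ ≤ t) :
    (prodBernoulli w).real {ω : BondConfig (Fin n) | (A.filter fun b => ω ∈ openConn o b).card ≤ 1} ≤ t := by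
  refine farRelayRow_layerOne_of_separated n w A o a {a} (fun h => hao (Set.mem_singleton_iff.1 h).symm) (Set.mem_singleton a)
    haA (fun b _ hba hb => hba (Set.mem_singleton_iff.1 hb)) (fun u v hu hv hvo => ?_) t hEN hcut
  rw [Set.mem_singleton_iff] at hu
  subst hu
  exact hpend v (fun h => hv (h ▸ Set.mem_singleton v)) hvo

end Quant

end Summit.CriticalPhenomena.PercolationContinuityZ3.Theorems

end
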